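import Summits.ValiantsHypothesis.ValiantsHypothesis.Theorems.GrenetZeonPolySizeQPAlgebraDepthAxis
import HarnessLib

/-!
# Semisimplification over an arbitrary coefficient algebra — the nilradical depth axis

Helper file for the piece `PolySizeQPAlgebra` (stmt-ValiantsHypothesis-8064, line `vbp-slice-dealg`)
of route `GrenetZeon`, companion of `GrenetZeonPolySizeQPAlgebraShallowSemisimple.lean` and
`GrenetZeonPolySizeQPAlgebraDepthAxis.lean`.

The landed semisimplification `eq_sum_dets_of_depth` is stated for a LOCAL (augmented) coefficient
algebra: a character `φ : R → k` with `(ker φ)^ν = 0`.  This file removes the locality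
hypothesis: for an ARBITRARY finite-dimensional commutative `k`-algebra `R` (`k` algebraically
closed, e.g. `ℂ`) whose nilradical satisfies `(nilradical R)^ν = 0`, every `(m, s)`-representation
`f = λ(det A)` over `R` is a `k`-linear combination of at most `s · (m (s - 1) + 1)^(ν - 1)` AFFINE
`m × m` determinants over `k` itself.

Proof (the product/CRT step recorded as missing in the census of stmt-8064): `R` is Artinian, so
by the Chinese remainder theorem `R ≅ ∏_𝔪 R ⧸ 𝔪^ν` over the (finitely many, at most `s`) maximal
ideals (`IsArtinianRing.quotNilradicalPowEquivPi`, `(nilradical R)^ν = ⋂ 𝔪^ν = 0`); a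
representation over a product is the sum of its components (`eq_sum_of_repr_pi`); each factor
`R ⧸ 𝔪^ν` is local with residue field `k` (algebraically closed), i.e. carries a character with
kernel `𝔪 / 𝔪^ν` of depth `ν` (`exists_character_quotient_pow`), so the local theorem applies
factor by factor.

## Main results

* `eq_sum_of_repr_pi` — product decomposition of a representation over `∏ᵢ Rᵢ`.
* `exists_character_of_isMaximal`, `exists_character_quotient_pow` — characters of
  finite-dimensional commutative algebras over an algebraically closed field.
* `card_maximalSpectrum_le_finrank` — a finite-dimensional commutative algebra has at most
  `dim R` maximal ideals.
* `eq_sum_dets_of_nilradical_pow` — **semisimplification for arbitrary `R`** with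
  `(nilradical R)^ν = 0`: `G ≤ s · (m (s - 1) + 1)^(ν - 1)` affine determinants of size `m`.
* `hasAlgDetRepr_semisimple_of_nilradical_pow` — packaged as a representation over the split
  semisimple algebra `k^G`.
* Companion file `GrenetZeonPolySizeQPAlgebraNilradicalDepthBox.lean`: `(nilradical R)^(dim R) = 0`
  (so UNCONDITIONALLY every `(m, s)`-representation is a sum of `≤ s (m (s - 1) + 1)^(s - 1)` affine
  `m × m` determinants), and the depth axis of stmt-8064 without locality (the ΣDet rung excludes
  every coefficient algebra of polylogarithmic nilpotency index inside the box).

No stub of the line is closed; `VP ≠ VNP` is not touched.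

## References

* P. Hrubeš, A. Yehudayoff, *Arithmetic complexity in ring extensions*, Theory of Computing 7
  (2011), §2 (the dimension parameter of a coefficient extension). [cite: HrubesYehudayoff2011, §2]
* Structure of Artinian rings (Atiyah–Macdonald, Thm. 8.7): Mathlib
  `IsArtinianRing.quotNilradicalPowEquivPi`.
-/

set_option linter.dupNamespace false

noncomputable section

namespace Summit.ValiantsHypothesis.ValiantsHypothesis.Theorems.GrenetZeonPolySizeQPAlgebra

open MvPolynomial Matrix
open Literature.Computability.AlgebraicComplexity
open Summit.ValiantsHypothesis.ValiantsHypothesis.Theses.GrenetZeon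

universe u v w

section Product

variable {k : Type u} [Field k] {σ : Type v}

/-- The `i`-th component of the determinant of a matrix over a product ring is the determinant of
the `i`-th component matrix (`RingHom.map_det` along the evaluation `∏ Rᵢ → Rᵢ`). [folklore] -/
theorem coeff_det_mapMatrix_eval {ι : Type w} {R : ι → Type u} [∀ i, CommRing (R i)] {m : ℕ}
    (A : Matrix (Fin m) (Fin m) (MvPolynomial σ (∀ i, R i))) (i : ι) (d : σ →₀ ℕ) :
    coeff d ((MvPolynomial.map (Pi.evalRingHom R i)).mapMatrix A).det = coeff d A.det i := by
  rw [← RingHom.map_det, coeff_map]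
  rfl

/-- **Product decomposition of a representation.** If `λ (coeff_d det A) = coeff_d f` for a matrix
`A` of polynomials over a finite product `∏ᵢ Rᵢ` of commutative `k`-algebras, then `f = Σᵢ fᵢ`
where `fᵢ` is read off the `i`-th component matrix through `λᵢ = λ ∘ (inclusion of Rᵢ)`:
`r = Σᵢ ιᵢ(rᵢ)` in the product and `λ` is additive. [folklore] -/
theorem eq_sum_of_repr_pi {ι : Type w} [Fintype ι] [DecidableEq ι] {R : ι → Type u}
    [∀ i, CommRing (R i)] [∀ i, Algebra k (R i)] {m : ℕ} {f : MvPolynomial σ k}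
    (l : (∀ i, R i) →ₗ[k] k) (A : Matrix (Fin m) (Fin m) (MvPolynomial σ (∀ i, R i)))
    (hf : ∀ d : σ →₀ ℕ, l (coeff d A.det) = coeff d f) :
    f = ∑ i, (AddMonoidAlgebra.map (l ∘ₗ LinearMap.single k R i).toAddMonoidHom
      ((MvPolynomial.map (Pi.evalRingHom R i)).mapMatrix A).det : MvPolynomial σ k) := by
  refine MvPolynomial.ext _ _ fun d => ?_
  rw [← hf d, coeff_sum]
  conv_lhs => rw [← Finset.univ_sum_single (coeff d A.det), map_sum]
  refine Finset.sum_congr rfl fun i _ => ?_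
  rw [coeff_mapCoord, coeff_det_mapMatrix_eval, LinearMap.comp_apply]
  rfl

/-- **Transport of a representation along an algebra isomorphism** `e : R ≃ₐ[k] R'`: push the
matrix forward along `e` (entries stay affine, `det` commutes with `e`) and read through
`λ ∘ e⁻¹`. [folklore] -/
theorem repr_transport {R R' : Type*} [CommRing R] [CommRing R'] [Algebra k R] [Algebra k R']
    (e : R ≃ₐ[k] R') {m : ℕ} {f : MvPolynomial σ k} (l : R →ₗ[k] k)
    (A : Matrix (Fin m) (Fin m) (MvPolynomial σ R)) (hA : ∀ i j, (A i j).totalDegree ≤ 1)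
    (hf : ∀ d : σ →₀ ℕ, l (coeff d A.det) = coeff d f) :
    (∀ i j, (((MvPolynomial.map (e : R →+* R')).mapMatrix A) i j).totalDegree ≤ 1) ∧
      ∀ d : σ →₀ ℕ, (l ∘ₗ e.symm.toLinearMap)
        (coeff d ((MvPolynomial.map (e : R →+* R')).mapMatrix A).det) = coeff d f := by
  refine ⟨fun i j => ?_, fun d => ?_⟩
  · rw [RingHom.mapMatrix_apply, Matrix.map_apply]
    exact (Finset.sup_mono (MvPolynomial.support_map_subset _ (A i j))).trans (hA i j)
  · rw [← RingHom.map_det, coeff_map, LinearMap.comp_apply, ← hf d]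
    exact congrArg l (e.symm_apply_apply _)

end Product

section Characters

variable {k : Type u} [Field k]

/-- Over an algebraically closed field `k`, a maximal ideal `I` of a finite-dimensional commutative
`k`-algebra `R` has residue field `k`: there is a character `φ : R →ₐ[k] k` with `ker φ = I`
(`R ⧸ I` is a finite field extension of `k`, hence `k` itself —
`IsAlgClosed.algebraMap_bijective_of_isIntegral`). [folklore] -/
theorem exists_character_of_isMaximal [IsAlgClosed k] {R : Type*} [CommRing R] [Algebra k R]
    [Module.Finite k R] (I : Ideal R) [I.IsMaximal] :
    ∃ φ : R →ₐ[k] k, RingHom.ker (φ : R →+* k) = I := by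
  haveI : Module.Finite k (R ⧸ I) :=
    Module.Finite.of_surjective (Ideal.Quotient.mkₐ k I).toLinearMap
      (Ideal.Quotient.mkₐ_surjective k I)
  have hbij := IsAlgClosed.algebraMap_bijective_of_isIntegral (k := k) (K := R ⧸ I)
  let e : k ≃ₐ[k] (R ⧸ I) := AlgEquiv.ofBijective (Algebra.ofId k (R ⧸ I)) hbij
  refine ⟨(e.symm : (R ⧸ I) →ₐ[k] k).comp (Ideal.Quotient.mkₐ k I), ?_⟩
  ext r
  rw [RingHom.mem_ker, AlgHom.coe_toRingHom, AlgHom.comp_apply, Ideal.Quotient.mkₐ_eq_mk,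
    AlgEquiv.coe_toAlgHom, map_eq_zero_iff _ e.symm.injective, Ideal.Quotient.eq_zero_iff_mem]

/-- The truncation `R ⧸ I^ν` at a maximal ideal `I` of a finite-dimensional commutative algebra
over an algebraically closed field is LOCAL OF DEPTH `ν` in the sense of `eq_sum_dets_of_depth`:
it carries a character `φ` with `(ker φ)^ν = 0` (namely `ker φ = I / I^ν`). [folklore] -/
theorem exists_character_quotient_pow [IsAlgClosed k] {R : Type*} [CommRing R] [Algebra k R]
    [Module.Finite k R] (I : Ideal R) [I.IsMaximal] (ν : ℕ) (hν : 1 ≤ ν) :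
    ∃ φ : (R ⧸ I ^ ν) →ₐ[k] k, RingHom.ker (φ : (R ⧸ I ^ ν) →+* k) ^ ν = ⊥ := by
  obtain ⟨ψ, hψ⟩ := exists_character_of_isMaximal (k := k) I
  have hIψ : ∀ a : R, a ∈ I ^ ν → ψ a = 0 := fun a ha => by
    have ha' : a ∈ I := Ideal.pow_le_self (by omega) ha
    rw [← hψ, RingHom.mem_ker] at ha'
    exact ha'
  refine ⟨Ideal.Quotient.liftₐ (I ^ ν) ψ hIψ, ?_⟩
  have hker : RingHom.ker (Ideal.Quotient.liftₐ (I ^ ν) ψ hIψ : (R ⧸ I ^ ν) →+* k) =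
      I.map (Ideal.Quotient.mk (I ^ ν)) := by
    apply le_antisymm
    · intro x hx
      obtain ⟨r, rfl⟩ := Ideal.Quotient.mk_surjective x
      rw [RingHom.mem_ker, AlgHom.coe_toRingHom, Ideal.Quotient.liftₐ_apply,
        Ideal.Quotient.lift_mk] at hx
      have hr : r ∈ I := by rw [← hψ, RingHom.mem_ker]; exact hx
      exact Ideal.mem_map_of_mem _ hr
    · rw [Ideal.map_le_iff_le_comap]
      intro r hr
      rw [Ideal.mem_comap, RingHom.mem_ker, AlgHom.coe_toRingHom, Ideal.Quotient.liftₐ_apply,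
        Ideal.Quotient.lift_mk]
      rw [← hψ, RingHom.mem_ker] at hr
      exact hr
  rw [hker, ← Ideal.map_pow, Ideal.map_quotient_self]

/-- A finite-dimensional commutative algebra over a field has at most `dim R` maximal ideals:
`R` surjects onto `∏_𝔪 R ⧸ 𝔪` (Chinese remainder theorem, `IsArtinianRing.quotNilradicalEquivPi`)
and every residue field has dimension `≥ 1`. [folklore] -/
theorem card_maximalSpectrum_le_finrank {R : Type u} [CommRing R] [Algebra k R]
    [Module.Finite k R] [Fintype (MaximalSpectrum R)] :
    Fintype.card (MaximalSpectrum R) ≤ Module.finrank k R := by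
  haveI : IsArtinianRing R := IsArtinianRing.of_finite k R
  -- the CRT surjection `R → ∏ R ⧸ 𝔪`, as a `k`-linear map
  let e := IsArtinianRing.quotNilradicalEquivPi R
  let π : R →ₗ[k] (∀ I : MaximalSpectrum R, R ⧸ I.asIdeal) :=
    (e.toLinearMap.restrictScalars k) ∘ₗ (Ideal.Quotient.mkₐ k (nilradical R)).toLinearMap
  have hπ : Function.Surjective π := fun y => by
    obtain ⟨x, hx⟩ := e.surjective y
    obtain ⟨r, rfl⟩ := Ideal.Quotient.mkₐ_surjective k (nilradical R) x
    exact ⟨r, hx⟩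
  haveI : ∀ I : MaximalSpectrum R, Module.Finite k (R ⧸ I.asIdeal) := fun I =>
    Module.Finite.of_surjective (Ideal.Quotient.mkₐ k I.asIdeal).toLinearMap
      (Ideal.Quotient.mkₐ_surjective k I.asIdeal)
  have h1 : Module.finrank k (∀ I : MaximalSpectrum R, R ⧸ I.asIdeal) ≤ Module.finrank k R :=
    LinearMap.finrank_le_finrank_of_surjective hπ
  have h2 : Module.finrank k (∀ I : MaximalSpectrum R, R ⧸ I.asIdeal) =
      ∑ I : MaximalSpectrum R, Module.finrank k (R ⧸ I.asIdeal) := Module.finrank_pi_fintype k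
  have h3 : ∀ I : MaximalSpectrum R, 1 ≤ Module.finrank k (R ⧸ I.asIdeal) := fun I => by
    haveI : Nontrivial (R ⧸ I.asIdeal) :=
      Ideal.Quotient.nontrivial_iff.mpr I.isMaximal.ne_top
    exact Module.finrank_pos
  calc Fintype.card (MaximalSpectrum R) = ∑ _I : MaximalSpectrum R, 1 := by simp
    _ ≤ ∑ I : MaximalSpectrum R, Module.finrank k (R ⧸ I.asIdeal) := Finset.sum_le_sum fun I _ => h3 I
    _ ≤ Module.finrank k R := h2 ▸ h1

end Characters

section Semisimplification

variable {k : Type u} [Field k] {σ : Type v}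

/-- Reindexing a double sum `Σᵢ Σ_{q < Gᵢ}` of scaled determinants as a single sum over
`Fin (Σᵢ Gᵢ)`. [folklore] -/
theorem exists_reindex_sum_sum_dets {ι : Type w} [Fintype ι] {m : ℕ} (G : ι → ℕ)
    (α : ∀ i, Fin (G i) → k) (B : ∀ i, Fin (G i) → Matrix (Fin m) (Fin m) (MvPolynomial σ k))
    (hB : ∀ i q a b, (B i q a b).totalDegree ≤ 1) :
    ∃ (N : ℕ) (α' : Fin N → k) (B' : Fin N → Matrix (Fin m) (Fin m) (MvPolynomial σ k)),
      N = ∑ i, G i ∧ (∀ q a b, (B' q a b).totalDegree ≤ 1) ∧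
        ∑ q, C (α' q) * (B' q).det = ∑ i, ∑ q, C (α i q) * (B i q).det := by
  classical
  let T := Σ i, Fin (G i)
  let e : T ≃ Fin (Fintype.card T) := Fintype.equivFin T
  refine ⟨Fintype.card T, fun q => α (e.symm q).1 (e.symm q).2, fun q => B (e.symm q).1 (e.symm q).2,
    ?_, fun q a b => hB _ _ a b, ?_⟩
  · rw [Fintype.card_sigma]
    simp only [Fintype.card_fin]
  · have h1 : ∑ i, ∑ q, C (α i q) * (B i q).det = ∑ t : T, C (α t.1 t.2) * (B t.1 t.2).det :=
      (Fintype.sum_sigma (fun t : T => C (α t.1 t.2) * (B t.1 t.2).det)).symm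
    rw [h1]
    exact (Fintype.sum_equiv e.symm _ _ fun q => rfl)

/-- **SEMISIMPLIFICATION OVER AN ARBITRARY COEFFICIENT ALGEBRA (the nilradical depth axis).**
Let `k` be algebraically closed, `R` a finite-dimensional commutative `k`-algebra with
`dim R ≤ s` whose nilradical satisfies `(nilradical R)^ν = 0`, and `f = λ(det A)` coefficientwise for
an `m × m` matrix `A` of affine forms over `R`.  Then `f` is a `k`-linear combination of at most
`s · (m (s - 1) + 1)^(ν - 1)` determinants of AFFINE `m × m` matrices over `k` itself.  By the
Chinese remainder theorem `R ≅ ∏_𝔪 R ⧸ 𝔪^ν` over the at most `s` maximal ideals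
(`IsArtinianRing.quotNilradicalPowEquivPi`); the representation is the sum of its components
(`eq_sum_of_repr_pi`), and each factor is local of depth `ν` with residue field `k`
(`exists_character_quotient_pow`), where the landed local semisimplification
`eq_sum_dets_of_depth_le` applies. [cite: HrubesYehudayoff2011, §2] -/
theorem eq_sum_dets_of_nilradical_pow [IsAlgClosed k] {f : MvPolynomial σ k} {m s : ℕ}
    {R : Type u} [CommRing R] [Algebra k R] [Module.Finite k R] {ν : ℕ}
    (hν : (nilradical R) ^ ν = ⊥) (hs : Module.finrank k R ≤ s) (l : R →ₗ[k] k)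
    (A : Matrix (Fin m) (Fin m) (MvPolynomial σ R)) (hA : ∀ i j, (A i j).totalDegree ≤ 1)
    (hf : ∀ d : σ →₀ ℕ, l (coeff d A.det) = coeff d f) :
    ∃ (G : ℕ) (α : Fin G → k) (B : Fin G → Matrix (Fin m) (Fin m) (MvPolynomial σ k)),
      G ≤ s * (m * (s - 1) + 1) ^ (ν - 1) ∧ (∀ q i j, (B q i j).totalDegree ≤ 1) ∧
        f = ∑ q, C (α q) * (B q).det := by
  classical
  rcases Nat.eq_zero_or_pos ν with hν0 | hν1
  · -- `ν = 0`: `⊤ = ⊥`, so `R = 0`, `λ = 0` and `f = 0` is the empty sum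
    subst hν0
    rw [pow_zero, Ideal.one_eq_top] at hν
    haveI : Subsingleton R := by
      refine subsingleton_of_zero_eq_one (Eq.symm ?_)
      have h1 : (1 : R) ∈ (⊤ : Ideal R) := Submodule.mem_top
      rw [hν, Ideal.mem_bot] at h1
      exact h1
    refine ⟨0, Fin.elim0, Fin.elim0, Nat.zero_le _, fun q => q.elim0, ?_⟩
    refine MvPolynomial.ext _ _ fun d => ?_
    rw [← hf d, Subsingleton.elim (coeff d A.det) 0, map_zero]
    simp
  haveI : IsArtinianRing R := IsArtinianRing.of_finite k R
  let ι := MaximalSpectrum R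
  haveI : Fintype ι := Fintype.ofFinite ι
  let Q : ι → Type u := fun I => R ⧸ I.asIdeal ^ ν
  -- the CRT isomorphism `R ≅ ∏ R ⧸ 𝔪^ν`, as a `k`-algebra isomorphism
  let e₀ : R ≃ₐ[R] (∀ I : ι, Q I) :=
    (((AlgEquiv.quotientBot R R).symm.trans
      (Ideal.quotientEquivAlgOfEq R hν.symm)).trans (IsArtinianRing.quotNilradicalPowEquivPi R ν))
  let e : R ≃ₐ[k] (∀ I : ι, Q I) := e₀.restrictScalars k
  -- transport the representation to the product
  obtain ⟨hA', hf'⟩ := repr_transport e l A hA hf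
  set A' := (MvPolynomial.map (e : R →+* ∀ I : ι, Q I)).mapMatrix A with hA'def
  set l' := l ∘ₗ e.symm.toLinearMap with hl'def
  -- decompose along the product
  have hdec := eq_sum_of_repr_pi l' A' hf'
  -- each factor is local of depth `ν` and dimension `≤ s`
  haveI hQfin : ∀ I : ι, Module.Finite k (Q I) := fun I =>
    Module.Finite.of_surjective (Ideal.Quotient.mkₐ k (I.asIdeal ^ ν)).toLinearMap
      (Ideal.Quotient.mkₐ_surjective k _)
  have hQdim : ∀ I : ι, Module.finrank k (Q I) ≤ s := fun I =>
    (LinearMap.finrank_le_finrank_of_surjective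
      (f := (Ideal.Quotient.mkₐ k (I.asIdeal ^ ν)).toLinearMap)
      (Ideal.Quotient.mkₐ_surjective k _)).trans hs
  have hAI : ∀ (I : ι) i j,
      (((MvPolynomial.map (Pi.evalRingHom Q I)).mapMatrix A') i j).totalDegree ≤ 1 :=
    fun I i j => by
      rw [RingHom.mapMatrix_apply, Matrix.map_apply]
      exact (Finset.sup_mono (MvPolynomial.support_map_subset _ (A' i j))).trans (hA' i j)
  have hloc : ∀ I : ι, ∃ (G : ℕ) (α : Fin G → k)
      (B : Fin G → Matrix (Fin m) (Fin m) (MvPolynomial σ k)),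
      G ≤ (m * (s - 1) + 1) ^ (ν - 1) ∧ (∀ q i j, (B q i j).totalDegree ≤ 1) ∧
        (AddMonoidAlgebra.map (l' ∘ₗ LinearMap.single k Q I).toAddMonoidHom
          ((MvPolynomial.map (Pi.evalRingHom Q I)).mapMatrix A').det : MvPolynomial σ k) =
          ∑ q, C (α q) * (B q).det := by
    intro I
    haveI : I.asIdeal.IsMaximal := I.isMaximal
    obtain ⟨φ, hφ⟩ := exists_character_quotient_pow (k := k) I.asIdeal ν hν1
    exact eq_sum_dets_of_depth_le φ hφ (hQdim I) (l' ∘ₗ LinearMap.single k Q I)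
      ((MvPolynomial.map (Pi.evalRingHom Q I)).mapMatrix A') (hAI I) fun d => rfl
  choose G α B hG hB hsum using hloc
  -- assemble
  obtain ⟨N, α', B', hN, hB', hsum'⟩ := exists_reindex_sum_sum_dets G α B hB
  refine ⟨N, α', B', ?_, hB', ?_⟩
  · rw [hN]
    calc ∑ I, G I ≤ ∑ _I : ι, (m * (s - 1) + 1) ^ (ν - 1) := Finset.sum_le_sum fun I _ => hG I
      _ = Fintype.card ι * (m * (s - 1) + 1) ^ (ν - 1) := by simp
      _ ≤ s * (m * (s - 1) + 1) ^ (ν - 1) :=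
          Nat.mul_le_mul_right _ ((card_maximalSpectrum_le_finrank (k := k)).trans hs)
  · rw [hsum', hdec]
    exact Finset.sum_congr rfl fun I _ => hsum I

/-- **Arbitrary coefficient algebras of nilpotency index `ν` semisimplify at the same matrix
size**: under the hypotheses of `eq_sum_dets_of_nilradical_pow`, `f` has an
`(m, s (m (s - 1) + 1)^(ν - 1))`-representation over the split semisimple algebra `k^G`
(`hasAlgDetRepr_sum_dets`). [cite: HrubesYehudayoff2011, §2] -/
theorem hasAlgDetRepr_semisimple_of_nilradical_pow [IsAlgClosed k] {f : MvPolynomial σ k}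
    {m s : ℕ} {R : Type u} [CommRing R] [Algebra k R] [Module.Finite k R] {ν : ℕ}
    (hν : (nilradical R) ^ ν = ⊥) (hs : Module.finrank k R ≤ s) (l : R →ₗ[k] k)
    (A : Matrix (Fin m) (Fin m) (MvPolynomial σ R)) (hA : ∀ i j, (A i j).totalDegree ≤ 1)
    (hf : ∀ d : σ →₀ ℕ, l (coeff d A.det) = coeff d f) :
    HasAlgDetRepr f m (s * (m * (s - 1) + 1) ^ (ν - 1)) := by
  obtain ⟨G, α, B, hG, hB, hfB⟩ := eq_sum_dets_of_nilradical_pow hν hs l A hA hf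
  have h := hasAlgDetRepr_sum_dets B hB α
  rw [← hfB] at h
  exact h.mono le_rfl hG

end Semisimplification

end Summit.ValiantsHypothesis.ValiantsHypothesis.Theorems.GrenetZeonPolySizeQPAlgebra

end
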